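import Summits.Ventures.PercRepro.ProfilePointedCircuitClassesStarSharpLoopD

/-!
# PercRepro — THE ALL-ON CORE OF `StarNineSharp` (THE LOOP REGIME OF D0), PART D1: THE PATH PATTERN
(p5, gen 55; `proofs/P5-GM1.md` §82 ADD 2 (f))

`not_path_bad`: three defects `{a, b}`, `{a, u}`, `{b, v}` with `u ≠ v` and `u, v ∉ C` are impossible
(`X = {a, b, u, v, p}`): (B1, B1) — `v` on the line `ef` inside the plane `{b, v, p} + e`; (B1, B2) — the plane
`{b, v, p} + e` contains `f ∈ cl{b, v}` and then `u ∈ cl{e, f}`, so `{u, v, p} + f` has rank `≤ 3`; (B2, B2) — the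
planes `{a, b, v, p} + f` and `{a, b, u, p} + f` meet in `{a, b, p, f}` of rank `≤ 2`, so `f ∈ cl{a, b}` drags
`u ∈ cl{a, f}` and `v ∈ cl{b, f}` onto the line `ab`, against `ρ(X) = 4`.
-/

open scoped Matroid

namespace PercRepro.Cogirth

open Finset ThmH Skew Shadow Profile

open Classical

variable {α : Type} [DecidableEq α] {N : Matroid α} [N.Finite]

section StarSharpLoopD1

variable {b b' : α}

/-- `{a, b, u, v, p} = {b, v, a, u, p}`. -/
theorem quint_perm_bvaup (a b u v p : α) : ({a, b, u, v, p} : Finset α) = {b, v, a, u, p} := by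
  ext x; simp only [mem_insert, mem_singleton]; tauto

/-- `{e, v} ⊆ insert e {b, v, p}`. -/
theorem pair_ev_subset_insert_e_bvp (e b v p : α) : ({e, v} : Finset α) ⊆ insert e {b, v, p} := by
  intro x hx; simp only [mem_insert, mem_singleton] at hx ⊢; tauto

/-- `{b, v} ⊆ insert e {b, v, p}`. -/
theorem pair_bv_subset_insert_e_bvp (e b v p : α) : ({b, v} : Finset α) ⊆ insert e {b, v, p} := by
  intro x hx; simp only [mem_insert, mem_singleton] at hx ⊢; tauto

/-- `{e, f} ⊆ insert f (insert e T)`. -/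
theorem pair_ef_subset_insert_f_insert_e (e f : α) (T : Finset α) : ({e, f} : Finset α) ⊆ insert f (insert e T) := by
  intro x hx; simp only [mem_insert, mem_singleton] at hx ⊢; tauto

/-- `insert f {u, v, p} ⊆ insert u (insert f (insert e {b, v, p}))`. -/
theorem insert_f_uvp_subset (e f b u v p : α) :
    insert f ({u, v, p} : Finset α) ⊆ insert u (insert f (insert e {b, v, p})) := by
  intro x hx; simp only [mem_insert, mem_singleton] at hx ⊢; tauto

/-- `insert f {u, v, p} ⊆ insert v (insert f (insert e {a, u, p}))`. -/
theorem insert_f_uvp_subset' (e f a u v p : α) :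
    insert f ({u, v, p} : Finset α) ⊆ insert v (insert f (insert e {a, u, p})) := by
  intro x hx; simp only [mem_insert, mem_singleton] at hx ⊢; tauto

/-- `{b, v} ⊆ {a, b, v, p}`. -/
theorem pair_bv_subset_quad (a b v p : α) : ({b, v} : Finset α) ⊆ {a, b, v, p} := by
  intro x hx; simp only [mem_insert, mem_singleton] at hx ⊢; tauto

/-- `{a, u} ⊆ {a, b, u, p}`. -/
theorem pair_au_subset_quad (a b u p : α) : ({a, u} : Finset α) ⊆ {a, b, u, p} := by
  intro x hx; simp only [mem_insert, mem_singleton] at hx ⊢; tauto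

/-- `insert f {a, b, p} ⊆ insert f {a, b, v, p} ∩ insert f {a, b, u, p}`. -/
theorem insert_f_abp_subset_inter (f a b u v p : α) :
    insert f ({a, b, p} : Finset α) ⊆ insert f {a, b, v, p} ∩ insert f {a, b, u, p} := by
  intro x hx; simp only [mem_insert, mem_singleton, mem_inter] at hx ⊢; tauto

/-- `{a, b, u, v, p} ⊆ insert f {a, b, v, p} ∪ insert f {a, b, u, p}`. -/
theorem quint_subset_union_insert_f (f a b u v p : α) :
    ({a, b, u, v, p} : Finset α) ⊆ insert f {a, b, v, p} ∪ insert f {a, b, u, p} := by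
  intro x hx; simp only [mem_insert, mem_singleton, mem_union] at hx ⊢; tauto

/-- `insert f {a, b} ⊆ insert f {a, b, p}`. -/
theorem insert_f_ab_subset_abp (f a b p : α) : insert f ({a, b} : Finset α) ⊆ insert f {a, b, p} := by
  intro x hx; simp only [mem_insert, mem_singleton] at hx ⊢; tauto

/-- `insert u {a, f} = insert f {a, u}`. -/
theorem insert_u_af_eq (a f u : α) : insert u ({a, f} : Finset α) = insert f {a, u} := by
  ext x; simp only [mem_insert, mem_singleton]; tauto

/-- `{a, f} ⊆ insert f {a, b}`. -/
theorem pair_af_subset_insert_f_ab (a b f : α) : ({a, f} : Finset α) ⊆ insert f {a, b} := by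
  intro x hx; simp only [mem_insert, mem_singleton] at hx ⊢; tauto

/-- `{b, f} ⊆ insert u (insert f {a, b})`. -/
theorem pair_bf_subset_insert_u_insert_f_ab (a b f u : α) : ({b, f} : Finset α) ⊆ insert u (insert f {a, b}) := by
  intro x hx; simp only [mem_insert, mem_singleton] at hx ⊢; tauto

/-- `{a, b, u, v, p} ⊆ insert p (insert v (insert u (insert f {a, b})))`. -/
theorem quint_subset_insert_chain (f a b u v p : α) :
    ({a, b, u, v, p} : Finset α) ⊆ insert p (insert v (insert u (insert f {a, b}))) := by
  intro x hx; simp only [mem_insert, mem_singleton] at hx ⊢; tauto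

/-- **THE PATH `{a, b}, {a, u}, {b, v}` WITH `u ≠ v`, `u, v ∉ C` IS IMPOSSIBLE** (`X = {a, b, u, v, p}`). -/
theorem not_path_bad {e f : α} (he : e ∈ gr N) (hf : f ∈ gr N) (hef : e ≠ f) (heb : e ≠ b) (heb' : e ≠ b')
    (he1 : ∀ y ∈ ((((gr N).erase b).erase b').erase f).erase e, rk N {e, y} = 2)
    (hf1 : ∀ y ∈ ((((gr N).erase b).erase b').erase f).erase e, rk N {f, y} = 2)
    (hfc : ∀ y ∈ ((((gr N).erase b).erase b').erase f).erase e, rk N (((((gr N).erase b).erase b').erase f).erase y) = 4)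
    (hX : rk N (((((gr N).erase b).erase b').erase f).erase e) = 4) (hef2 : rk N {e, f} = 2)
    {a u v p : α} {bq : α} (hau : a ≠ u) (hbu : bq ≠ u) (huv : u ≠ v) (hup : u ≠ p) (hbv : bq ≠ v) (hav : a ≠ v)
    (hvp : v ≠ p)
    (hu : u ∈ ((((gr N).erase b).erase b').erase f).erase e) (hv : v ∈ ((((gr N).erase b).erase b').erase f).erase e)
    (hXeq : ((((gr N).erase b).erase b').erase f).erase e = {a, bq, u, v, p})
    (hYab : rk N (insert e {a, bq}) = 3) (hYcab : rk N (insert f {u, v, p}) = 4)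
    (hYau : rk N (insert e {a, u}) = 3) (hYcau : rk N (insert f {bq, v, p}) = 4)
    (hbau : ¬ (rk N (insert f {a, u}) = 3 ∧ rk N (insert e {bq, v, p}) = 4))
    (hYbv : rk N (insert e {bq, v}) = 3) (hYcbv : rk N (insert f {a, u, p}) = 4)
    (hbbv : ¬ (rk N (insert f {bq, v}) = 3 ∧ rk N (insert e {a, u, p}) = 4))
    (hu' : ¬ (rk N {e, f, u} = 3 ∧ rk N {a, bq, v, p} = 4))
    (hv' : ¬ (rk N {e, f, v} = 3 ∧ rk N {a, bq, u, p} = 4)) : False := by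
  have hE7g : ((gr N).erase b).erase b' ⊆ gr N := (erase_subset _ _).trans (erase_subset _ _)
  have hXg : ((((gr N).erase b).erase b').erase f).erase e ⊆ gr N :=
    ((erase_subset _ _).trans (erase_subset _ _)).trans hE7g
  have ha : a ∈ ((((gr N).erase b).erase b').erase f).erase e := by rw [hXeq]; exact mem_insert_self _ _
  have hb : bq ∈ ((((gr N).erase b).erase b').erase f).erase e := by
    rw [hXeq]; exact mem_insert_of_mem (mem_insert_self _ _)
  have hp : p ∈ ((((gr N).erase b).erase b').erase f).erase e := by
    rw [hXeq]
    exact mem_insert_of_mem (mem_insert_of_mem (mem_insert_of_mem (mem_insert_of_mem (mem_singleton_self _))))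
  have hag := hXg ha
  have hbg := hXg hb
  have hug := hXg hu
  have hvg := hXg hv
  have hpg := hXg hp
  have hab2 := rk_pair_eq_two_of_insert_e he hag hbg hYab
  have hau2 := rk_pair_eq_two_of_insert_e he hag hug hYau
  have hbv2 := rk_pair_eq_two_of_insert_e he hbg hvg hYbv
  have hbvp3 := rk_triple_eq_three_of_insert_f hf hbg hvg hpg hYcau
  have haup3 := rk_triple_eq_three_of_insert_f hf hag hug hpg hYcbv
  -- ranges
  have hfau_lo : rk N ({a, u} : Finset α) ≤ rk N (insert f ({a, u} : Finset α)) := rk_mono' (subset_insert _ _)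
  have hfau_hi := rk_insert_le_add_one (N := N) hf (X := ({a, u} : Finset α)) (by
    intro x hx; simp only [mem_insert, mem_singleton] at hx; rcases hx with rfl | rfl <;> assumption)
  have hfbv_lo : rk N ({bq, v} : Finset α) ≤ rk N (insert f ({bq, v} : Finset α)) := rk_mono' (subset_insert _ _)
  have hfbv_hi := rk_insert_le_add_one (N := N) hf (X := ({bq, v} : Finset α)) (by
    intro x hx; simp only [mem_insert, mem_singleton] at hx; rcases hx with rfl | rfl <;> assumption)
  have hebvp_lo : rk N ({bq, v, p} : Finset α) ≤ rk N (insert e ({bq, v, p} : Finset α)) := rk_mono' (subset_insert _ _)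
  have hebvp_hi := rk_insert_le_add_one (N := N) he (X := ({bq, v, p} : Finset α)) (by
    intro x hx; simp only [mem_insert, mem_singleton] at hx; rcases hx with rfl | rfl | rfl <;> assumption)
  have heaup_lo : rk N ({a, u, p} : Finset α) ≤ rk N (insert e ({a, u, p} : Finset α)) := rk_mono' (subset_insert _ _)
  have heaup_hi := rk_insert_le_add_one (N := N) he (X := ({a, u, p} : Finset α)) (by
    intro x hx; simp only [mem_insert, mem_singleton] at hx; rcases hx with rfl | rfl | rfl <;> assumption)
  have hefu_lo : rk N ({e, u} : Finset α) ≤ rk N ({e, f, u} : Finset α) := rk_mono' (pair_et_subset_eft e f u)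
  have hefu_hi := rk_insert_le_add_one (N := N) hug (X := ({e, f} : Finset α)) (by
    intro x hx; simp only [mem_insert, mem_singleton] at hx; rcases hx with rfl | rfl <;> assumption)
  rw [← triple_eq_insert_last, hef2] at hefu_hi
  rw [he1 u hu] at hefu_lo
  have hefv_lo : rk N ({e, v} : Finset α) ≤ rk N ({e, f, v} : Finset α) := rk_mono' (pair_et_subset_eft e f v)
  have hefv_hi := rk_insert_le_add_one (N := N) hvg (X := ({e, f} : Finset α)) (by
    intro x hx; simp only [mem_insert, mem_singleton] at hx; rcases hx with rfl | rfl <;> assumption)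
  rw [← triple_eq_insert_last, hef2] at hefv_hi
  rw [he1 v hv] at hefv_lo
  -- the B1 facts
  have hK1a : rk N (insert e ({bq, v, p} : Finset α)) = 3 → rk N ({a, bq, v, p} : Finset α) = 4 := fun hB1 =>
    rk_quad_eq_four_of_B1 he hf hef heb heb' hfc hau hbu.symm huv hup hu (by rw [hXeq, quint_swap_bu]) hYcau hB1
  have hK1b : rk N (insert e ({a, u, p} : Finset α)) = 3 → rk N ({a, bq, u, p} : Finset α) = 4 := by
    intro hB1
    have := rk_quad_eq_four_of_B1 he hf hef heb heb' hfc hbv hav.symm huv.symm hvp hv (by rw [hXeq, quint_perm_bvaup])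
      hYcbv hB1
    rw [quad_swap12'] at this
    exact this
  -- the B2 facts
  have hK2a : rk N (insert f ({a, u} : Finset α)) = 2 → rk N ({e, f, u} : Finset α) = 3 := fun hB2 =>
    rk_eft_eq_three_of_B2 he hf hf1 hef2 hu hYau hB2
  have hK2b : rk N (insert f ({bq, v} : Finset α)) = 2 → rk N ({e, f, v} : Finset α) = 3 := fun hB2 =>
    rk_eft_eq_three_of_B2 he hf hf1 hef2 hv hYbv hB2
  have hT1 : rk N (insert f ({a, u} : Finset α)) = 2 ∨ rk N (insert e ({bq, v, p} : Finset α)) = 3 := by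
    by_contra hne
    push Not at hne
    exact hbau ⟨by omega, by omega⟩
  have hT2 : rk N (insert f ({bq, v} : Finset α)) = 2 ∨ rk N (insert e ({a, u, p} : Finset α)) = 3 := by
    by_contra hne
    push Not at hne
    exact hbbv ⟨by omega, by omega⟩
  -- `X` has rank 4 in the explicit form
  have hX' : rk N ({a, bq, u, v, p} : Finset α) = 4 := by rw [← hXeq]; exact hX
  rcases hT1 with hB2a | hB1a <;> rcases hT2 with hB2b | hB1b
  · -- (B2, B2)
    have hefu3 := hK2a hB2a
    have hefv3 := hK2b hB2b
    have hle1 : rk N ({a, bq, v, p} : Finset α) ≤ 3 := by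
      have h1 : ¬ rk N ({a, bq, v, p} : Finset α) = 4 := fun h' => hu' ⟨hefu3, h'⟩
      have h2 := rk_le_card' (M := N) ({a, bq, v, p} : Finset α)
      have h3 : ({a, bq, v, p} : Finset α).card ≤ 4 := by
        calc ({a, bq, v, p} : Finset α).card ≤ ({bq, v, p} : Finset α).card + 1 := card_insert_le _ _
          _ ≤ ({v, p} : Finset α).card + 1 + 1 := by gcongr; exact card_insert_le _ _
          _ ≤ ({p} : Finset α).card + 1 + 1 + 1 := by gcongr; exact card_insert_le _ _
          _ = 4 := by rw [card_singleton]
      omega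
    have hle2 : rk N ({a, bq, u, p} : Finset α) ≤ 3 := by
      have h1 : ¬ rk N ({a, bq, u, p} : Finset α) = 4 := fun h' => hv' ⟨hefv3, h'⟩
      have h2 := rk_le_card' (M := N) ({a, bq, u, p} : Finset α)
      have h3 : ({a, bq, u, p} : Finset α).card ≤ 4 := by
        calc ({a, bq, u, p} : Finset α).card ≤ ({bq, u, p} : Finset α).card + 1 := card_insert_le _ _
          _ ≤ ({u, p} : Finset α).card + 1 + 1 := by gcongr; exact card_insert_le _ _
          _ ≤ ({p} : Finset α).card + 1 + 1 + 1 := by gcongr; exact card_insert_le _ _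
          _ = 4 := by rw [card_singleton]
      omega
    have hf_bv : rk N (insert f ({bq, v} : Finset α)) = rk N ({bq, v} : Finset α) := by rw [hB2b, hbv2]
    have hf_au : rk N (insert f ({a, u} : Finset α)) = rk N ({a, u} : Finset α) := by rw [hB2a, hau2]
    have h1 := rk_insert_eq_of_rk_insert_eq_subset' (N := N) (S := ({bq, v} : Finset α))
      (S' := ({a, bq, v, p} : Finset α)) (w := f) (pair_bv_subset_quad a bq v p) hf_bv
    have h2 := rk_insert_eq_of_rk_insert_eq_subset' (N := N) (S := ({a, u} : Finset α))
      (S' := ({a, bq, u, p} : Finset α)) (w := f) (pair_au_subset_quad a bq u p) hf_au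
    have h3 := rk_le_two_of_two_planes (N := N) (insert_f_abp_subset_inter f a bq u v p)
      (quint_subset_union_insert_f f a bq u v p) hX' (by omega) (by omega)
    have hfab : rk N (insert f ({a, bq} : Finset α)) = rk N ({a, bq} : Finset α) := by
      have h4 : rk N (insert f ({a, bq} : Finset α)) ≤ rk N (insert f ({a, bq, p} : Finset α)) :=
        rk_mono' (insert_f_ab_subset_abp f a bq p)
      have h5 : rk N ({a, bq} : Finset α) ≤ rk N (insert f ({a, bq} : Finset α)) := rk_mono' (subset_insert _ _)
      omega
    -- `u ∈ cl{a, f}`, `v ∈ cl{bq, f}`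
    have hu_af : rk N (insert u ({a, f} : Finset α)) = rk N ({a, f} : Finset α) := by
      rw [insert_u_af_eq, hB2a, pair_comm' a f, hf1 a ha]
    have hv_bf : rk N (insert v ({bq, f} : Finset α)) = rk N ({bq, f} : Finset α) := by
      rw [insert_u_af_eq, hB2b, pair_comm' bq f, hf1 bq hb]
    have h6 := rk_insert_eq_of_rk_insert_eq_subset' (N := N) (S := ({a, f} : Finset α))
      (S' := insert f ({a, bq} : Finset α)) (w := u) (pair_af_subset_insert_f_ab a bq f) hu_af
    have h7 := rk_insert_eq_of_rk_insert_eq_subset' (N := N) (S := ({bq, f} : Finset α))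
      (S' := insert u (insert f ({a, bq} : Finset α))) (w := v) (pair_bf_subset_insert_u_insert_f_ab a bq f u) hv_bf
    have h8 := rk_insert_le_add_one (N := N) hpg (X := insert v (insert u (insert f ({a, bq} : Finset α)))) (by
      intro x hx; simp only [mem_insert, mem_singleton] at hx
      rcases hx with rfl | rfl | rfl | rfl | rfl <;> assumption)
    have h9 : rk N ({a, bq, u, v, p} : Finset α) ≤ rk N (insert p (insert v (insert u (insert f ({a, bq} : Finset α))))) :=
      rk_mono' (quint_subset_insert_chain f a bq u v p)
    rw [hX'] at h9
    rw [h7, h6, hfab, hab2] at h8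
    omega
  · -- (B2 for `{a, u}`, B1 for `{bq, v}`): `v` on `ef` inside the plane `{a, u, p} + e ∋ f`
    have h4 := hK1b hB1b
    have hefv2 : rk N ({e, f, v} : Finset α) = 2 := by
      have : ¬ rk N ({e, f, v} : Finset α) = 3 := fun h' => hv' ⟨h', h4⟩
      omega
    have hf_au : rk N (insert f ({a, u} : Finset α)) = rk N ({a, u} : Finset α) := by rw [hB2a, hau2]
    have h5 := rk_insert_eq_of_rk_insert_eq_subset' (N := N) (S := ({a, u} : Finset α))
      (S' := insert e ({a, u, p} : Finset α)) (w := f) (pair_bv_subset_insert_e_bvp e a u p) hf_au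
    have hv_ef : rk N (insert v ({e, f} : Finset α)) = rk N ({e, f} : Finset α) := by
      rw [← triple_eq_insert_last, hefv2, hef2]
    have h6 := rk_insert_eq_of_rk_insert_eq_subset' (N := N) (S := ({e, f} : Finset α))
      (S' := insert f (insert e ({a, u, p} : Finset α))) (w := v) (pair_ef_subset_insert_f_insert_e e f _) hv_ef
    have h7 : rk N (insert f ({u, v, p} : Finset α)) ≤ rk N (insert v (insert f (insert e ({a, u, p} : Finset α)))) :=
      rk_mono' (insert_f_uvp_subset' e f a u v p)
    rw [hYcab, h6, h5, hB1b] at h7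
    omega
  · -- (B1 for `{a, u}`, B2 for `{bq, v}`): `u` on `ef` inside the plane `{bq, v, p} + e ∋ f`
    have h4 := hK1a hB1a
    have hefu2 : rk N ({e, f, u} : Finset α) = 2 := by
      have : ¬ rk N ({e, f, u} : Finset α) = 3 := fun h' => hu' ⟨h', h4⟩
      omega
    have hf_bv : rk N (insert f ({bq, v} : Finset α)) = rk N ({bq, v} : Finset α) := by rw [hB2b, hbv2]
    have h5 := rk_insert_eq_of_rk_insert_eq_subset' (N := N) (S := ({bq, v} : Finset α))
      (S' := insert e ({bq, v, p} : Finset α)) (w := f) (pair_bv_subset_insert_e_bvp e bq v p) hf_bv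
    have hu_ef : rk N (insert u ({e, f} : Finset α)) = rk N ({e, f} : Finset α) := by
      rw [← triple_eq_insert_last, hefu2, hef2]
    have h6 := rk_insert_eq_of_rk_insert_eq_subset' (N := N) (S := ({e, f} : Finset α))
      (S' := insert f (insert e ({bq, v, p} : Finset α))) (w := u) (pair_ef_subset_insert_f_insert_e e f _) hu_ef
    have h7 : rk N (insert f ({u, v, p} : Finset α)) ≤ rk N (insert u (insert f (insert e ({bq, v, p} : Finset α)))) :=
      rk_mono' (insert_f_uvp_subset e f bq u v p)
    rw [hYcab, h6, h5, hB1a] at h7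
    omega
  · -- (B1, B1): `v` on the line `ef` inside the plane `{bq, v, p} + e`
    have h4 := hK1b hB1b
    have hefv2 : rk N ({e, f, v} : Finset α) = 2 := by
      have : ¬ rk N ({e, f, v} : Finset α) = 3 := fun h' => hv' ⟨h', h4⟩
      omega
    exact not_on_line_ef_of_plane (N := N) hB1a hYcau (pair_ev_subset_insert_e_bvp e bq v p) (he1 v hv) hefv2

end StarSharpLoopD1

end PercRepro.Cogirth
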